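import Mathlib
import HarnessLib
import Summits.HubbardSuperconductivity.HubbardSuperconductivity.Theorems.KLProgrammeKLRegimeEngineMeanFreeBaseFrame
import Summits.HubbardSuperconductivity.HubbardSuperconductivity.Theorems.KLProgrammeKLRegimeEngineFlowPieceIncrementData

/-!
# Route `KLProgramme` — crux K3 ENGINE (stmt-HubbardSuperconductivity-20437) stub (b) conj. 2 «(c-D)² FAMILY TELESCOPE», brick (D5r): the
# MEAN-FREE CHAIN OF FRAMES `K♯_i := K_i ⊖ Σ_{i≤m<n} mean_m` — its consecutive band increments are the mean-free flow pieces, and its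
# order-three data are affine in `4^i`

Cell `gate-hubbard-kl`, seat hubbard-kl-k3c3-p2 (g11); F1-DESIGN §10.  The telescope (`…EngineSliceFamBandTel`) runs along
`K♯_i = fsub (klFlowFrameU i) (symInterp L fun _ => Σ_{m ∈ Ico i n} klAngularMean (klLocalPart … (klFlowFrameU m) m))`, `m₀ ≤ i ≤ n`
(at `i = m₀` this is p3's mean-free base frame of `…EngineMeanFreeBaseFrame`; at `i = n` the sum is empty).

* `frameLevel_meanFreeChain_succ_sub` — `e_{K♯_{i+1}} − e_{K♯_i} = evalM (klFlowPiece i) − mean_i` (`i < n`);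
* `norm_iteratedFDeriv_three_meanFreeChain_le` — `‖D³(frameShift K♯_i)‖ ≤ (Gfr₃U²/3)·4^i` and `‖D³ e_{K♯_i}‖ ≤ 64 + (Gfr₃U²/3)·4^i` from
  (I-F jets) at every `m′ < i`.

Everything is proved; no definitions, no sorry. [cite: BenfattoGiulianiMastropietro2006, §3 (3.2)–(3.3)]
-/

noncomputable section

namespace Summit.HubbardSuperconductivity.HubbardSuperconductivity.Theorems.KLRegimeSplit

set_option linter.dupNamespace false -- summit = problem name (single-conjunct summit), D-0017

open Real Finset Literature.MathematicalPhysics.QuantumLattice Literature.Probability.LatticeModels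
open Literature.MathematicalPhysics.QuantumLattice.FermiRG
open Summit.HubbardSuperconductivity.HubbardSuperconductivity.Theorems.DispersionFlow

variable {L M : ℕ} [NeZero L] [NeZero M]

/-- **Consecutive band increments of the mean-free chain are the mean-free flow pieces** (`i < n`). [folklore] -/
theorem frameLevel_meanFreeChain_succ_sub (β U μ : ℝ) {i n : ℕ} (hin : i < n) :
    (fun q : Momentum => frameLevel μ (fsub (klFlowFrameU L M β U μ (i + 1)) (symInterp L fun _ =>
        ∑ m ∈ Ico (i + 1) n, klAngularMean (klLocalPart L M β U μ (klFlowFrameU L M β U μ m) m))) q -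
      frameLevel μ (fsub (klFlowFrameU L M β U μ i) (symInterp L fun _ =>
        ∑ m ∈ Ico i n, klAngularMean (klLocalPart L M β U μ (klFlowFrameU L M β U μ m) m))) q) =
    fun q => evalM (klFlowPiece L M β U μ i) q - klAngularMean (klLocalPart L M β U μ (klFlowFrameU L M β U μ i) i) := by
  funext q
  rw [EngineV8.frameLevel_eq_zero_sub_evalM μ (fsub (klFlowFrameU L M β U μ (i + 1)) _), EngineV8.frameLevel_eq_zero_sub_evalM μ (fsub (klFlowFrameU L M β U μ i) _),
    evalM_fsub, evalM_fsub, klFlowFrameU_succ, evalM_fsub, Finset.sum_eq_sum_Ico_succ_bot hin]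
  simp only [evalM_symInterp_const]
  ring

/-- **Order-three data of the mean-free chain, affine in `4^i`**, from (I-F jets) at every `m′ < i` (`Gfr ≥ 0`).
[cite: BenfattoGiulianiMastropietro2006, §3 (3.3)] -/
theorem norm_iteratedFDeriv_three_meanFreeChain_le {β U μ : ℝ} {R : RenConsts} (hR : ∀ j, 0 ≤ R.Gfr j) {i n : ℕ}
    (hJ : ∀ m' < i, FlowPieceJetsAt L M β U μ R m') (p : Momentum) :
    ‖iteratedFDeriv ℝ 3 (frameShift (fsub (klFlowFrameU L M β U μ i) (symInterp L fun _ =>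
        ∑ m ∈ Ico i n, klAngularMean (klLocalPart L M β U μ (klFlowFrameU L M β U μ m) m)))) p‖ ≤ R.Gfr 3 * U ^ 2 / 3 * (4 : ℝ) ^ i ∧
    ‖iteratedFDeriv ℝ 3 (frameLevel μ (fsub (klFlowFrameU L M β U μ i) (symInterp L fun _ =>
        ∑ m ∈ Ico i n, klAngularMean (klLocalPart L M β U μ (klFlowFrameU L M β U μ m) m)))) p‖ ≤ 64 + R.Gfr 3 * U ^ 2 / 3 * (4 : ℝ) ^ i := by
  rw [iteratedFDeriv_frameShift_fsub_symInterp_const _ _ (by norm_num), iteratedFDeriv_frameLevel_fsub_symInterp_const _ _ _ (by norm_num)]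
  -- the geometric sum of the piece third derivatives
  have e3 : uPow 3 U = U ^ 2 := by rw [show (3 : ℕ) = 2 + 1 by rfl, uPow_succ]
  have hterm : ∀ m' : ℕ, (4 : ℝ) ^ ((((3 : ℕ) : ℤ) - 2) * (m' : ℤ)) = (4 : ℝ) ^ m' := fun m' => by
    rw [show (((3 : ℕ) : ℤ) - 2) * (m' : ℤ) = ((m' : ℕ) : ℤ) by push_cast; ring, zpow_natCast]
  have hgeom : ∀ k : ℕ, ∑ m' ∈ range k, (4 : ℝ) ^ m' ≤ (4 : ℝ) ^ k / 3 := by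
    intro k
    induction k with
    | zero => simp
    | succ k ih => rw [Finset.sum_range_succ, pow_succ]; linarith
  have hsum : ∑ m' ∈ range i, R.Gfr 3 * uPow 3 U * (4 : ℝ) ^ ((((3 : ℕ) : ℤ) - 2) * (m' : ℤ)) ≤ R.Gfr 3 * U ^ 2 / 3 * (4 : ℝ) ^ i := by
    calc ∑ m' ∈ range i, R.Gfr 3 * uPow 3 U * (4 : ℝ) ^ ((((3 : ℕ) : ℤ) - 2) * (m' : ℤ)) = R.Gfr 3 * U ^ 2 * ∑ m' ∈ range i, (4 : ℝ) ^ m' := by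
          rw [Finset.mul_sum]; exact Finset.sum_congr rfl fun m' _ => by rw [e3, hterm]
      _ ≤ R.Gfr 3 * U ^ 2 * ((4 : ℝ) ^ i / 3) := mul_le_mul_of_nonneg_left (hgeom i) (by have := hR 3; positivity)
      _ = R.Gfr 3 * U ^ 2 / 3 * (4 : ℝ) ^ i := by ring
  constructor
  · -- `frameShift K = −evalM K`
    have hfs : frameShift (klFlowFrameU L M β U μ i) = fun q => (-1 : ℝ) • evalM (klFlowFrameU L M β U μ i) q := by
      funext q; rw [frameShift_eq_neg_evalM]; simp
    rw [hfs, iteratedFDeriv_const_smul_apply' (contDiff_evalM _).contDiffAt, norm_smul, Real.norm_eq_abs, abs_neg, abs_one, one_mul]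
    exact (EngineV8.norm_iteratedFDeriv_evalM_klFlowFrameU_le_sum
      (pj := fun m' j => R.Gfr j * uPow j U * (4 : ℝ) ^ (((j : ℤ) - 2) * m')) (fun m' hm' q => hJ m' hm' 3 (by norm_num) q) p).trans hsum
  · have h0 := EngineV8.norm_iteratedFDeriv_frameLevel_klFlowFrameU_le (L := L) (M := M) (β := β) (U := U) (μ := μ) (i := 3)
      (by norm_num) (by norm_num) hJ p
    have e64 : (4 : ℝ) ^ (3 : ℕ) = 64 := by norm_num
    rw [e64] at h0
    exact h0.trans (add_le_add le_rfl hsum)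

end Summit.HubbardSuperconductivity.HubbardSuperconductivity.Theorems.KLRegimeSplit

end
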